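import Mathlib
import HarnessLib
import Summits.KontsevichZagierPeriods.Zeta5Search.TwoTaleWhippleDischarged
import Summits.KontsevichZagierPeriods.Zeta5Search.Denom.TwoTaleD1Forms

/-!
# TwoTaleWhippleD1 — Whipple's transformation at RUNG D1 = L(1/3): `q_n = −q̂_n` over the Literature's closed forms

HONEST FRAMING: systematic search; no irrationality claim unless certified.  Cell pub-zeta5 (P1 g12, file T9 of
fam-denom's `families/denom/D1-DESIGN-NOTE.md`, Phase 1); the D1 twin of `TwoTaleWhippleP15`.  No new input: the tree
theorem `TwoTaleWhipple.whippleRemark5Max_holds` (Whipple's terminating nearly-poised `₄F₃(1)` ↔ Saalschützian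
`₅F₄(1)` transformation [Zudilin2014ZetaTwo, Remark 5], proved by fam-measure) is instantiated at the cone point
`a = (19n+1, 16n+1, 13n+1, 22n+1)`, `b = (1, 3n+1, 6n+1, 38n+2)` (`Denom.TwoTaleD1Forms.aD1/bD1`), whose Remark-5
partner is `â = (47n+2; 16n+1, 19n+1, 22n+1)`, `b̂ = (22n+2; 9n+1, 35n+2, 38n+2)` (`Denom.TwoTaleD1Forms.aTD1/bTD1`):
* `aD1_eq/bD1_eq/aTD1_eq/bTD1_eq` — the D1 data ARE `firstA/firstB/hatA/hatB (19n+1) (16n+1) (13n+1) (22n+1) (38n+2)`;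
* `admissibleTD1` — second-tale admissibility of the partner (`admissibleT_hat`), `rangeD1_eq` (`â₃* = 22n+1`,
  `b̂₂* = 35n+2`);
* **`formQD1_eq_neg_formQTZ`**: `formQD1 n = −formQTZ (aTD1 n) (bTD1 n)` for `n ≥ 1` (`19n+1, 16n+1, 13n+1 ≤ 22n+1`)
  — the identity that transfers second-tale divisibilities to `q_n` in fam-denom's `InclusionD1`.
The reindexing `formQTZ (aTD1 n) (bTD1 n) = qhatD1 n` (one-signed binomial sum) and `CoeffRateD1 C₁starD1` are in
`TwoTaleD1GrowthLimit`.  Nothing here certifies a measure; no irrationality content.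
References: W. Zudilin, arXiv:1310.1526 [Zudilin2014ZetaTwo] §6 and Remark 5; W. N. Bailey, Generalized hypergeometric
series (1935) §4.5.
-/

noncomputable section

namespace Summit.KontsevichZagierPeriods.Zeta5Search.TwoTaleWhippleD1

open Finset
open Literature.NumberTheory.Irrationality.Zudilin2014
open Summit.KontsevichZagierPeriods.Zeta5Search
open Summit.KontsevichZagierPeriods.Zeta5Search.TwoTaleWhipple
open Summit.KontsevichZagierPeriods.Zeta5Search.Denom.TwoTaleD1Forms

/-! ### The dictionary at D1 -/

/-- D1 first tale `a = (19n+1, 16n+1, 13n+1, 22n+1)` is Remark-5 numerator data. -/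
theorem aD1_eq (n : ℕ) : aD1 n = firstA (19 * n + 1) (16 * n + 1) (13 * n + 1) (22 * n + 1) := by
  ext i; fin_cases i <;> simp

/-- D1 first tale `b = (1, 3n+1, 6n+1, 38n+2)` has the Remark-5 shape `(1, a₄−a₁+1, a₄−a₂+1, b₄)`. -/
theorem bD1_eq (n : ℕ) : bD1 n = firstB (19 * n + 1) (16 * n + 1) (22 * n + 1) (38 * n + 2) := by
  ext i; fin_cases i <;> simp
  all_goals ring

/-- `aTD1` is the Remark-5 `hatA` of the D1 data. -/
theorem aTD1_eq (n : ℕ) : aTD1 n = hatA (19 * n + 1) (16 * n + 1) (13 * n + 1) (22 * n + 1) (38 * n + 2) := by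
  ext i; fin_cases i <;> simp
  all_goals ring

/-- `bTD1` is the Remark-5 `hatB` of the D1 data. -/
theorem bTD1_eq (n : ℕ) : bTD1 n = hatB (19 * n + 1) (16 * n + 1) (13 * n + 1) (22 * n + 1) (38 * n + 2) := by
  ext i; fin_cases i <;> simp
  all_goals ring

/-- The D1 partner is second-tale admissible for `n ≥ 1`. -/
theorem admissibleTD1 {n : ℕ} (hn : 1 ≤ n) : AdmissibleT (aTD1 n) (bTD1 n) := by
  rw [aTD1_eq, bTD1_eq]
  refine admissibleT_hat ?_
  rw [← aD1_eq, ← bD1_eq]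
  exact admissibleD1 hn

/-- `â₃* = 22n+1`, `b̂₂* = 35n+2` at D1. -/
theorem rangeD1_eq (n : ℕ) : aMax3 (aTD1 n) = 22 * (n : ℤ) + 1 ∧ bMin (bTD1 n) = 35 * (n : ℤ) + 2 := by
  constructor
  · unfold aMax3; simp; omega
  · unfold bMin; simp; omega

/-! ### Whipple at D1 -/

/-- **`q_n = −q̂_n` at D1**: `formQD1 n = −formQTZ (aTD1 n) (bTD1 n)` for `n ≥ 1`, from the tree theorem
`whippleRemark5Max_holds` (`19n+1, 16n+1, 13n+1 ≤ 22n+1`). -/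
theorem formQD1_eq_neg_formQTZ {n : ℕ} (hn : 1 ≤ n) : formQD1 n = -formQTZ (aTD1 n) (bTD1 n) := by
  unfold formQD1
  rw [aD1_eq, bD1_eq, aTD1_eq, bTD1_eq]
  refine whippleRemark5Max_holds _ _ _ _ _ (by omega) (by omega) (by omega) ?_
  rw [← aD1_eq, ← bD1_eq]
  exact admissibleD1 hn

end Summit.KontsevichZagierPeriods.Zeta5Search.TwoTaleWhippleD1

end
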